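import Summits.QuantumFields.BalabanUV.Beta.D1BFx.PackedCoframePairLoc
import Summits.QuantumFields.BalabanUV.Beta.D1BFx.TorusWeightMixedLimit

/-!
# BetaPertH road «BF-x» — «COFRAME-PACK-2» P4b: the entrywise limit of the packed twisted mixed co-frame table

STATUS: [folklore] `ℓ¹` bookkeeping (Tannery) for the road's (A1)-PACKED identity (BINDER row D1, slot (K), chain step (I)); NOT an estimate of
Bałaban's, NOT a discharge of any root-level binder.  Provenance: reconstruction; the manuscript(s) under audit are NOT citable.

WHAT ((u2) of PART 4's N-side socket `hlimWN` for the co-frame half).  Along the road's tori `s_k = (m+1)·p k`, `p k → ∞`, every entry of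
`cofPair s_k (m+1) a w w′` converges to the corresponding entry of the `s`-FREE table `cofPairInf (m+1) a w w′` (TA2's arrays `arr s Z → Z`,
the periodised weight `perW s w′ → w′`; dominated convergence through the tree's uniform-`BiLoc` socket lemmas):
* §1 [our objects] `l2WInf`, `k9Inf`, `k5Inf`, `k7Inf`, `k4Inf`, **`cofPairInf`** (the kernels of P3a∕P3b with `arr s` erased and `perW s w′ ↦ w′`).
* §2 [folklore] the letters `tendsto_perW`, `tendsto_d2W`, `tendsto_l2W`, `tendsto_jetCw_mul_perW_apply` and the inner words.
* §3 [folklore] `tendsto_k9 ∕ k5 ∕ k7 ∕ k4`, **`tendsto_cofPair`**.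
Unit `b2b-balaban-beta-d1-formalise-leaf-03` (gen 23); road owner `b2b-balaban-beta-d1-p2` (W-d1p2-g18-4∕-5, journal l.40583).
-/

noncomputable section

namespace Summit.QuantumFields.BalabanUV.Beta.D1BFx.PackedCoframePairLimit

open Filter Topology
open scoped BigOperators
open Literature.MathematicalPhysics.QuantumFieldTheory.Balaban1983to89
open Literature.MathematicalPhysics.QuantumFieldTheory.Balaban1983to89.Beta
open B12Sec2to5 (l1 l1_nonneg)
open ExpKernelCalculus (MKer BiLoc Decays comp Zl biLoc_comp_decays)
open BalabanStepJetsSucc (biLoc_comp_right)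
open Summit.QuantumFields.BalabanUV.Beta.TameKernelCalculus (decays_of_le trK)
open Summit.QuantumFields.BalabanUV.Beta.D1BFx.PeriodicArrays (arr tendsto_arr)
open Summit.QuantumFields.BalabanUV.Beta.D1BFx.RJetProjector (Rgt)
open Summit.QuantumFields.BalabanUV.Beta.D1BFx.RJetAssembly (dSw)
open Summit.QuantumFields.BalabanUV.Beta.D1BFx.KGhostLeg (Cgh)
open Summit.QuantumFields.BalabanUV.Beta.D1BFx.GhostStencil (l1_zero)
open Summit.QuantumFields.BalabanUV.Beta.D1BFx.TorusGhostWordArrays (lapU decays_lapU)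
open Summit.QuantumFields.BalabanUV.Beta.D1BFx.TorusGhostPairStencils (biLoc_gh₂)
open Summit.QuantumFields.BalabanUV.Beta.D1BFx.TorusBondArrays (dB dB_pos decays_lapU_Cgh decays_Cgh_lapU)
open Summit.QuantumFields.BalabanUV.Beta.D1BFx.TorusMixedLetters (decays_Cgh_dB)
open Summit.QuantumFields.BalabanUV.Beta.D1BFx.TorusTwoArrayWords (biLoc_comp_arr tendsto_comp_arr_apply)
open Summit.QuantumFields.BalabanUV.Beta.D1BFx.TorusArrayLimitUniform (tendsto_comp_apply_of_uniform)
open Summit.QuantumFields.BalabanUV.Beta.D1BFx.TorusWeightMixedLimit (tendsto_dSw_apply tendsto_comp_right_of_uniform tendsto_sigma)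
open Summit.QuantumFields.BalabanUV.Beta.D1BFx.PackedPinnedLetters (jetRw jetCw jetRCw jetCw_apply)
open Summit.QuantumFields.BalabanUV.Beta.D1BFx.PackedPinnedLettersLoc (tendsto_jetRw_apply tendsto_jetCw_apply tendsto_jetRCw_apply)
open Summit.QuantumFields.BalabanUV.Beta.D1BFx.PeriodicArrayPackingPlain (tendsto_dirsum_wsum_per_apply)
open Summit.QuantumFields.BalabanUV.Beta.D1BFx.PackedCoframeSiteWords (perW gW qW d2W l2W biLoc_gW biLoc_qW biLoc_d2W_perW biLoc_l2W rate_aux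
  biLoc_LC_gW biLoc_gW_CL biLoc_gW_Cgh biLoc_LC_qW biLoc_LC_qW_CL biLoc_LC_qW_Cgh)
open Summit.QuantumFields.BalabanUV.Beta.D1BFx.PackedCoframePairLoc (k9 k5 k7 k4 cofPair)

/-! ## §1 The `s`-free kernels -/

section Kernels

variable (n : ℕ) [NeZero n] (a : ℝ) (w w' : Fin 4 → (Fin 4 → ℤ) → ℝ)

/-- [our object] `l2WInf w w′ := d2W w w′ ∘ lapU + gW w ∘ gW w′ + gW w′ ∘ gW w + lapU ∘ d2W w w′`. A definition. -/
def l2WInf : MKer 4 Unit := comp (d2W w w') lapU + comp (gW w) (gW w') + comp (gW w') (gW w) + comp lapU (d2W w w')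

/-- [our object] `k9Inf` (P3b's `k9` with `arr s` erased and `perW s w′ ↦ w′`). A definition. -/
def k9Inf : MKer 4 (Fin 4) :=
  dSw (comp (comp lapU (Cgh n a)) (d2W w w')) - jetCw w' (comp (comp lapU (Cgh n a)) (gW w))
    - jetCw w (comp (comp lapU (Cgh n a)) (gW w')) + jetCw (fun κ u => w κ u * w' κ u) (Rgt n a)

/-- [our object] `k5Inf`. A definition. -/
def k5Inf : MKer 4 (Fin 4) :=
  dSw (comp (comp (gW w) (Cgh n a)) (gW w')) - jetCw w' (comp (gW w) (comp (Cgh n a) lapU))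
    + jetRw w (comp (comp lapU (Cgh n a)) (gW w')) - jetRCw w w' (Rgt n a)

/-- [our object] `k7Inf`. A definition. -/
def k7Inf : MKer 4 (Fin 4) :=
  -dSw (comp (comp (comp (comp lapU (Cgh n a)) (qW w)) (Cgh n a)) (gW w'))
    + jetCw w' (comp (comp (comp lapU (Cgh n a)) (qW w)) (comp (Cgh n a) lapU))

/-- [our object] `k4Inf`. A definition. -/
def k4Inf : MKer 4 (Fin 4) :=
  -dSw (comp (comp (comp lapU (Cgh n a)) (l2WInf w w')) (comp (Cgh n a) lapU))
    + dSw (comp (comp (comp (comp (comp lapU (Cgh n a)) (qW w)) (Cgh n a)) (qW w')) (comp (Cgh n a) lapU))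
    + dSw (comp (comp (comp (comp (comp lapU (Cgh n a)) (qW w')) (Cgh n a)) (qW w)) (comp (Cgh n a) lapU))

/-- [our object] **THE LIMIT TABLE** `cofPairInf := 2 • (trK k9Inf + trK (k7Inf w′ w) + trK (k7Inf w w′) + k4Inf + k5Inf + trK k5Inf + k7Inf w w′ + k7Inf w′ w + k9Inf)`
— PART 4's `𝒲N∞` co-frame half. A definition; asserts nothing. -/
def cofPairInf : MKer 4 (Fin 4) :=
  (2 : ℝ) • (trK (k9Inf n a w w') + trK (k7Inf n a w' w) + trK (k7Inf n a w w') + k4Inf n a w w' + k5Inf n a w w' + trK (k5Inf n a w w')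
    + k7Inf n a w w' + k7Inf n a w' w + k9Inf n a w w')

end Kernels

/-! ## §2 The letters and the inner words along `s_k = (m+1)·p k → ∞` -/

section Letters

variable (m : ℕ) {a : ℝ} (p : ℕ → ℕ) [∀ k, NeZero (p k)] {w w' : Fin 4 → (Fin 4 → ℤ) → ℝ} {C C' δ : ℝ} {P P' : Fin 4 → ℤ}
  (ha : 0 < a) (hw : ∀ κ u, |w κ u| ≤ C * Real.exp (-δ * l1 (u - P))) (hw' : ∀ κ u, |w' κ u| ≤ C' * Real.exp (-δ * l1 (u - P')))
  (hδ : 0 < δ) (hδB : δ ≤ dB (m + 1) a / 8) (hp : Tendsto p atTop atTop)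

omit [∀ k, NeZero (p k)] in
include hw' hδ hp in
/-- [folklore] `perW s_k w′ κ u → w′ κ u` (gan24-leaf-05 `tendsto_tsum_images`). -/
theorem tendsto_perW (κ : Fin 4) (u : Fin 4 → ℤ) : Tendsto (fun k => perW ((m + 1) * p k) w' κ u) atTop (𝓝 (w' κ u)) :=
  (PeriodicArrayWrapLimit.tendsto_tsum_images (hw' κ) hδ u).comp (tendsto_sigma m p hp)

omit [∀ k, NeZero (p k)] in
include hw hw' hδ hp in
/-- [folklore] `d2W w (perW s_k w′) → d2W w w′` entrywise (FILE 1 `tendsto_dirsum_wsum_per_apply`). -/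
theorem tendsto_d2W (x y : Fin 4 → ℤ) (a' b' : Unit) :
    Tendsto (fun k => d2W w (perW ((m + 1) * p k) w') x y a' b') atTop (𝓝 (d2W w w' x y a' b')) :=
  tendsto_dirsum_wsum_per_apply (d := 3) hw hw' (fun κ u => biLoc_gh₂ κ u δ) hδ (PeriodicArrayWrapLimit.const_nonneg_of_weight (hw 0))
    (tendsto_sigma m p hp) x y a' b'

include hw hw' hδ hp in
/-- [folklore] `l2W s_k w w′ → l2WInf w w′` entrywise. -/
theorem tendsto_l2W (hδ1 : δ ≤ 1) (x y : Fin 4 → ℤ) (a' b' : Unit) :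
    Tendsto (fun k => l2W ((m + 1) * p k) w w' x y a' b') atTop (𝓝 (l2WInf w w' x y a' b')) := by
  have hσ := tendsto_sigma m p hp
  have hL : Decays lapU (|16 * Real.exp 1|) (δ / 2) := decays_of_le decays_lapU (by linarith)
  have hD : ∀ k, BiLoc (d2W w (perW ((m + 1) * p k) w')) P P _ (δ / 2) := fun k => biLoc_d2W_perW hw hw' hδ _
  have T1 := tendsto_comp_right_of_uniform hL (half_pos hδ) hD (half_pos hδ) (tendsto_d2W m p hw hw' hδ hp) x y a' b'
  have T4 := tendsto_comp_apply_of_uniform hL (half_pos hδ) hD (half_pos hδ) (tendsto_d2W m p hw hw' hδ hp) x y a' b'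
  have T2 := tendsto_comp_arr_apply (biLoc_gW hw hδ) (biLoc_gW hw' hδ) (half_pos hδ) hσ x y a' b'
  have T3 := tendsto_comp_arr_apply (biLoc_gW hw' hδ) (biLoc_gW hw hδ) (half_pos hδ) hσ x y a' b'
  simp only [l2W, l2WInf, Pi.add_apply]
  exact ((T1.add T2).add T3).add T4

omit [∀ k, NeZero (p k)] in
include hw' hδ hp in
/-- [folklore] **(u2) FOR `jetCw (w · perW s_k w′) Y`** (fixed `Y`, the product weight's periodised factor converges). -/
theorem tendsto_jetCw_mul_perW_apply (Y : MKer 4 Unit) (x z : Fin 4 → ℤ) (α β : Fin 4) :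
    Tendsto (fun k => jetCw (fun κ u => w κ u * perW ((m + 1) * p k) w' κ u) Y x z α β) atTop
      (𝓝 (jetCw (fun κ u => w κ u * w' κ u) Y x z α β)) := by
  simp only [jetCw_apply]
  exact ((tendsto_const_nhds.mul (tendsto_perW m p hw' hδ hp β z)).mul tendsto_const_nhds)

include ha hw hw' hδ hδB hp

/-- [folklore] `(lapU∘Cgh) ∘ d2W w (perW s_k w′) → (lapU∘Cgh) ∘ d2W w w′`. -/
theorem tendsto_LC_d2W (x y : Fin 4 → ℤ) (a' b' : Unit) :
    Tendsto (fun k => comp (comp lapU (Cgh (m + 1) a)) (d2W w (perW ((m + 1) * p k) w')) x y a' b') atTop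
      (𝓝 (comp (comp lapU (Cgh (m + 1) a)) (d2W w w') x y a' b')) := by
  obtain ⟨-, -, h3, hd⟩ := rate_aux m ha hδ hδB
  obtain ⟨CA, hA⟩ := decays_lapU_Cgh (m + 1) a ha
  exact tendsto_comp_apply_of_uniform hA (half_pos hd) (fun k => biLoc_d2W_perW hw hw' hδ _) (half_pos hδ) (tendsto_d2W m p hw hw' hδ hp) x y a' b'

/-- [folklore] `((lapU∘Cgh) ∘ l2W s_k) ∘ (Cgh∘lapU) → ((lapU∘Cgh) ∘ l2WInf) ∘ (Cgh∘lapU)`. -/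
theorem tendsto_LC_l2W_CL (x y : Fin 4 → ℤ) (a' b' : Unit) :
    Tendsto (fun k => comp (comp (comp lapU (Cgh (m + 1) a)) (l2W ((m + 1) * p k) w w')) (comp (Cgh (m + 1) a) lapU) x y a' b') atTop
      (𝓝 (comp (comp (comp lapU (Cgh (m + 1) a)) (l2WInf w w')) (comp (Cgh (m + 1) a) lapU) x y a' b')) := by
  obtain ⟨h1, -, h3, hd⟩ := rate_aux m ha hδ hδB
  obtain ⟨CA, hA⟩ := decays_lapU_Cgh (m + 1) a ha
  obtain ⟨CB, hB⟩ := decays_Cgh_lapU (m + 1) a ha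
  obtain ⟨K, -, hK⟩ := biLoc_l2W hw hw' hδ h1
  have hX : ∀ k, BiLoc (comp (comp lapU (Cgh (m + 1) a)) (l2W ((m + 1) * p k) w w')) P P _ (δ / 16) := fun k =>
    biLoc_comp_decays (decays_of_le hA (by linarith : δ / 8 ≤ dB (m + 1) a / 2)) (hK _) (by linarith : 0 ≤ δ / 16) (by linarith)
  have limX := tendsto_comp_apply_of_uniform hA (half_pos hd) (fun k => hK ((m + 1) * p k)) (by linarith) (tendsto_l2W m p hw hw' hδ hp h1)
  exact tendsto_comp_right_of_uniform hB (half_pos hd) hX (by linarith) limX x y a' b'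

/-- [folklore] `(gW w ∘ Cgh) ∘ arr s_k (gW w′) → (gW w ∘ Cgh) ∘ gW w′`. -/
theorem tendsto_gW_Cgh_arr_gW (x y : Fin 4 → ℤ) (a' b' : Unit) :
    Tendsto (fun k => comp (comp (gW w) (Cgh (m + 1) a)) (arr ((m + 1) * p k) (gW w')) x y a' b') atTop
      (𝓝 (comp (comp (gW w) (Cgh (m + 1) a)) (gW w') x y a' b')) := by
  obtain ⟨K, -, hK⟩ := biLoc_gW_Cgh m ha hw hδ hδB
  exact tendsto_comp_arr_apply hK (StepJetData.biLoc_weaken (biLoc_gW hw' hδ) le_rfl (by linarith)) (by linarith) (tendsto_sigma m p hp) x y a' b'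

/-- [folklore] `(((lapU∘Cgh) ∘ qW w) ∘ Cgh) ∘ arr s_k (gW w′) → … ∘ gW w′`. -/
theorem tendsto_LC_qW_Cgh_arr_gW (x y : Fin 4 → ℤ) (a' b' : Unit) :
    Tendsto (fun k => comp (comp (comp (comp lapU (Cgh (m + 1) a)) (qW w)) (Cgh (m + 1) a)) (arr ((m + 1) * p k) (gW w')) x y a' b') atTop
      (𝓝 (comp (comp (comp (comp lapU (Cgh (m + 1) a)) (qW w)) (Cgh (m + 1) a)) (gW w') x y a' b')) := by
  obtain ⟨K, -, hK⟩ := biLoc_LC_qW_Cgh m ha hw hδ hδB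
  exact tendsto_comp_arr_apply hK (StepJetData.biLoc_weaken (biLoc_gW hw' hδ) le_rfl (by linarith)) (by linarith) (tendsto_sigma m p hp) x y a' b'

/-- [folklore] `((((lapU∘Cgh) ∘ qW w) ∘ Cgh) ∘ arr s_k (qW w′)) ∘ (Cgh∘lapU) → (… ∘ qW w′) ∘ (Cgh∘lapU)`. -/
theorem tendsto_LC_qW_Cgh_arr_qW_CL (x y : Fin 4 → ℤ) (a' b' : Unit) :
    Tendsto (fun k => comp (comp (comp (comp (comp lapU (Cgh (m + 1) a)) (qW w)) (Cgh (m + 1) a)) (arr ((m + 1) * p k) (qW w')))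
        (comp (Cgh (m + 1) a) lapU) x y a' b') atTop
      (𝓝 (comp (comp (comp (comp (comp lapU (Cgh (m + 1) a)) (qW w)) (Cgh (m + 1) a)) (qW w')) (comp (Cgh (m + 1) a) lapU) x y a' b')) := by
  obtain ⟨h1, -, h3, hd⟩ := rate_aux m ha hδ hδB
  obtain ⟨K, -, hK⟩ := biLoc_LC_qW_Cgh m ha hw hδ hδB
  obtain ⟨CB, hB⟩ := decays_Cgh_lapU (m + 1) a ha
  have hq' := StepJetData.biLoc_weaken (biLoc_qW hw' hδ h1) le_rfl (by linarith : δ / 16 ≤ δ / 4)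
  have hX : ∀ k, BiLoc (comp (comp (comp (comp lapU (Cgh (m + 1) a)) (qW w)) (Cgh (m + 1) a)) (arr ((m + 1) * p k) (qW w'))) P P _ (δ / 16 / 4) :=
    fun k => biLoc_comp_arr _ hK hq' (by linarith)
  have limX := tendsto_comp_arr_apply hK hq' (by linarith) (tendsto_sigma m p hp)
  exact tendsto_comp_right_of_uniform hB (half_pos hd) hX (by linarith) limX x y a' b'

end Letters

/-! ## §3 The limits of the kernels -/

section Kernels

variable (m : ℕ) {a : ℝ} (p : ℕ → ℕ) [∀ k, NeZero (p k)] {w w' : Fin 4 → (Fin 4 → ℤ) → ℝ} {C C' δ : ℝ} {P P' : Fin 4 → ℤ}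
  (ha : 0 < a) (hw : ∀ κ u, |w κ u| ≤ C * Real.exp (-δ * l1 (u - P))) (hw' : ∀ κ u, |w' κ u| ≤ C' * Real.exp (-δ * l1 (u - P')))
  (hδ : 0 < δ) (hδB : δ ≤ dB (m + 1) a / 8) (hp : Tendsto p atTop atTop)
include ha hw hw' hδ hδB hp

omit [∀ k, NeZero (p k)] ha hw hw' hδ hδB in
/-- [folklore] The array of a fixed localised site kernel converges entrywise along `s_k` (TA2 `tendsto_arr`). -/
theorem tendsto_arr_sigma {Z : MKer 4 Unit} {P₀ Q₀ : Fin 4 → ℤ} {K θ : ℝ} (hZ : BiLoc Z P₀ Q₀ K θ) (hθ : 0 < θ) (x z : Fin 4 → ℤ) :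
    Tendsto (fun k => arr ((m + 1) * p k) Z x z () ()) atTop (𝓝 (Z x z () ())) :=
  (tendsto_arr hZ hθ x z () ()).comp (tendsto_sigma m p hp)

/-- [folklore] **(u2) FOR `k9`**. -/
theorem tendsto_k9 (x z : Fin 4 → ℤ) (α β : Fin 4) :
    Tendsto (fun k => k9 ((m + 1) * p k) (m + 1) a w w' x z α β) atTop (𝓝 (k9Inf (m + 1) a w w' x z α β)) := by
  obtain ⟨K₁, -, hK₁⟩ := biLoc_LC_gW m ha hw hδ hδB
  obtain ⟨K₂, -, hK₂⟩ := biLoc_LC_gW m ha hw' hδ hδB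
  have T1 := tendsto_dSw_apply (fun x y a' b' => tendsto_LC_d2W m p ha hw hw' hδ hδB hp x y a' b') x z α β
  have T2 := tendsto_jetCw_apply (ω := w') (fun x z => tendsto_arr_sigma m p hp hK₁ (by linarith) x z) x z α β
  have T3 := tendsto_jetCw_apply (ω := w) (fun x z => tendsto_arr_sigma m p hp hK₂ (by linarith) x z) x z α β
  have T4 := tendsto_jetCw_mul_perW_apply m p hw' hδ hp (w := w) (Rgt (m + 1) a) x z α β
  simp only [k9, k9Inf, Pi.add_apply, Pi.sub_apply]
  exact ((T1.sub T2).sub T3).add T4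

/-- [folklore] **(u2) FOR `k5`**. -/
theorem tendsto_k5 (x z : Fin 4 → ℤ) (α β : Fin 4) :
    Tendsto (fun k => k5 ((m + 1) * p k) (m + 1) a w w' x z α β) atTop (𝓝 (k5Inf (m + 1) a w w' x z α β)) := by
  obtain ⟨K₁, -, hK₁⟩ := biLoc_gW_CL m ha hw hδ hδB
  obtain ⟨K₂, -, hK₂⟩ := biLoc_LC_gW m ha hw' hδ hδB
  have T1 := tendsto_dSw_apply (fun x y a' b' => tendsto_gW_Cgh_arr_gW m p ha hw hw' hδ hδB hp x y a' b') x z α β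
  have T2 := tendsto_jetCw_apply (ω := w') (fun x z => tendsto_arr_sigma m p hp hK₁ (by linarith) x z) x z α β
  have T3 := tendsto_jetRw_apply (ω := w) (fun x z => tendsto_arr_sigma m p hp hK₂ (by linarith) x z) x z α β
  have T4 := tendsto_jetRCw_apply (ω := w) (Yk := fun _ => Rgt (m + 1) a) (fun β z => tendsto_perW m p hw' hδ hp β z)
    (fun x z => tendsto_const_nhds) x z α β
  simp only [k5, k5Inf, Pi.add_apply, Pi.sub_apply]
  exact ((T1.sub T2).add T3).sub T4

/-- [folklore] **(u2) FOR `k7`**. -/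
theorem tendsto_k7 (x z : Fin 4 → ℤ) (α β : Fin 4) :
    Tendsto (fun k => k7 ((m + 1) * p k) (m + 1) a w w' x z α β) atTop (𝓝 (k7Inf (m + 1) a w w' x z α β)) := by
  obtain ⟨K₁, -, hK₁⟩ := biLoc_LC_qW_CL m ha hw hδ hδB
  have T1 := tendsto_dSw_apply (fun x y a' b' => tendsto_LC_qW_Cgh_arr_gW m p ha hw hw' hδ hδB hp x y a' b') x z α β
  have T2 := tendsto_jetCw_apply (ω := w') (fun x z => tendsto_arr_sigma m p hp hK₁ (by linarith) x z) x z α β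
  simp only [k7, k7Inf, Pi.add_apply, Pi.neg_apply]
  exact T1.neg.add T2

/-- [folklore] **(u2) FOR `k4`**. -/
theorem tendsto_k4 (x z : Fin 4 → ℤ) (α β : Fin 4) :
    Tendsto (fun k => k4 ((m + 1) * p k) (m + 1) a w w' x z α β) atTop (𝓝 (k4Inf (m + 1) a w w' x z α β)) := by
  have T1 := tendsto_dSw_apply (fun x y a' b' => tendsto_LC_l2W_CL m p ha hw hw' hδ hδB hp x y a' b') x z α β
  have T2 := tendsto_dSw_apply (fun x y a' b' => tendsto_LC_qW_Cgh_arr_qW_CL m p ha hw hw' hδ hδB hp x y a' b') x z α β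
  have T3 := tendsto_dSw_apply (fun x y a' b' => tendsto_LC_qW_Cgh_arr_qW_CL m p ha hw' hw hδ hδB hp x y a' b') x z α β
  simp only [k4, k4Inf, Pi.add_apply, Pi.neg_apply]
  exact (T1.neg.add T2).add T3

/-- [folklore] **(u2) FOR THE CO-FRAME HALF — `cofPair s_k (m+1) a w w′ → cofPairInf (m+1) a w w′` ENTRYWISE** along `p k → ∞`. -/
theorem tendsto_cofPair (x z : Fin 4 → ℤ) (α β : Fin 4) :
    Tendsto (fun k => cofPair ((m + 1) * p k) (m + 1) a w w' x z α β) atTop (𝓝 (cofPairInf (m + 1) a w w' x z α β)) := by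
  have T9 := tendsto_k9 m p ha hw hw' hδ hδB hp
  have T5 := tendsto_k5 m p ha hw hw' hδ hδB hp
  have T7 := tendsto_k7 m p ha hw hw' hδ hδB hp
  have T8 := tendsto_k7 m p ha hw' hw hδ hδB hp
  have T4 := tendsto_k4 m p ha hw hw' hδ hδB hp
  simp only [cofPair, cofPairInf, Pi.smul_apply, Pi.add_apply, smul_eq_mul]
  exact ((((((((((T9 z x β α).add (T8 z x β α)).add (T7 z x β α)).add (T4 x z α β)).add (T5 x z α β)).add (T5 z x β α)).add (T7 x z α β)).add
    (T8 x z α β)).add (T9 x z α β)).const_mul 2)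

end Kernels

end Summit.QuantumFields.BalabanUV.Beta.D1BFx.PackedCoframePairLimit

end
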